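import Mathlib
import HarnessLib
import Summits.ValiantsHypothesis.ValiantsHypothesis.Theorems.LacunarySymmetroidMatrixDescartesProductPlusOneSharpKStrictAnti
import Summits.ValiantsHypothesis.ValiantsHypothesis.Theorems.LacunarySymmetroidMatrixDescartesProductPlusOneEulerRolle
import Summits.ValiantsHypothesis.ValiantsHypothesis.Theorems.LacunarySymmetroidMatrixDescartesProductPlusOnePosCoeff

/-!
# ValiantsHypothesis / LacunarySymmetroid — crux `MatrixDescartes` (stmt-ValiantsHypothesis-18050, V1),
# LINE (A) «product_plus_one»: the SHARP SECTOR for GENERAL `K` — part 4, THE COUNT: `Z₊ ≤ 2((K−1)m + 1)`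

**`sharpK_sector_pos_roots`**: `m` Descartes-sharp fewnomials `f_j = Σ_{i ≤ K} c_{ji} X^{d_i}` on a common strictly increasing support
(`K ≥ 1`, all `c_{ji} ≠ 0`, each `f_j` with `K` distinct positive zeros), any coupling exponent `N`, any real `κ`:
`Z₊(κ X^N + ∏_j f_j) ≤ 2(Km + 1)`.  Mechanism = ✓ `…SharpSector` (`K = 2` there) with ✓ `sharp_phi_strictAnti` (part 3b) in place of
the trinomial certificate: `Φ = Σ_j x f_j′/f_j` is strictly decreasing on zero-free intervals, zeros of `X h′ − N h = P(Φ − N)` separate the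
member's zeros (Rolle for `θ_N`, ✓ `exists_root_euler_between`), so each of the `≤ Km + 1` zero-free components carries at most two.
**`sharpK_sector_class`**: the line's member shape `C c * X ^ (m * d l₀) + ∏ j, Σ_l C (a j l) * X ^ (d l)` with `d : Fin K → ℕ` strictly
increasing (`K ≥ 2`), ANY `l₀`, all `a j l ≠ 0`, every factor with `K − 1` distinct positive zeros ⇒ `Z₊ ≤ 2((K−1)m + 1)` — the SHARP
SECTOR OF `PPOLinearLaw` FOR EVERY FORMAT (val-v1x-eng-10's «all-sharp ⇒ linear», ×2 for the sign-blind fibre count).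

HONEST FRAMING: a SECTOR (all factors Descartes-sharp); NOT `stub_classRowK3`, not `stub_eulerBoundK3`, not `stub_polyLaw`, not
`ProductPlusOneMDR`, not `MatrixDescartes`, not Conjecture B; `VP ≠ VNP` is NOT proved.  No definitions, no named facts.
-/

-- `Summit.ValiantsHypothesis.ValiantsHypothesis.…` is the tree's mandated single-conjunct layout (Sub = Summit).
set_option linter.dupNamespace false

namespace Summit.ValiantsHypothesis.ValiantsHypothesis.Theorems.LacunarySymmetroidMatrixDescartes

namespace ProductPlusOne

open Polynomial Finset
open scoped BigOperators

/-- **`x·P′(x) = P(x)·Σ_j x f_j′(x)/f_j(x)` off the zeros** (logarithmic derivative of a product). [folklore] -/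
theorem eval_euler_prod_general {m : ℕ} (f : Fin m → ℝ[X]) {w : ℝ} (hf : ∀ j, (f j).eval w ≠ 0) :
    w * (derivative (∏ j, f j)).eval w = (∏ j, (f j).eval w) * ∑ j, w * (derivative (f j)).eval w / (f j).eval w := by
  classical
  rw [derivative_prod_finset, eval_finsetSum, Finset.mul_sum, Finset.mul_sum]
  refine Finset.sum_congr rfl (fun j _ => ?_)
  rw [eval_mul, eval_prod]
  have h := Finset.mul_prod_erase Finset.univ (fun i => (f i).eval w) (Finset.mem_univ j)
  have hfj := hf j
  rw [← h]
  field_simp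

/-- The product of sharp factors has at most `K·m` positive zeros, and is nonzero. [folklore] -/
theorem prod_sparse_pos_roots_le {m : ℕ} (K : ℕ) (d : ℕ → ℕ) (hd : StrictMono d) (c : Fin m → ℕ → ℝ)
    (hc : ∀ j i, i < K + 1 → c j i ≠ 0) :
    (∏ j, (∑ i ∈ Finset.range (K + 1), C (c j i) * X ^ (d i) : ℝ[X])) ≠ 0 ∧
    ((∏ j, (∑ i ∈ Finset.range (K + 1), C (c j i) * X ^ (d i) : ℝ[X])).roots.toFinset.filter
      (fun t => 0 < t)).card ≤ K * m := by
  classical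
  have hne : ∀ j, (∑ i ∈ Finset.range (K + 1), C (c j i) * X ^ (d i) : ℝ[X]) ≠ 0 :=
    fun j => (sparse_leadingCoeff K d hd (c j) (hc j K (by omega))).2
  have hP0 : (∏ j, (∑ i ∈ Finset.range (K + 1), C (c j i) * X ^ (d i) : ℝ[X])) ≠ 0 :=
    Finset.prod_ne_zero_iff.mpr (fun j _ => hne j)
  refine ⟨hP0, ?_⟩
  have hsub : ((∏ j, (∑ i ∈ Finset.range (K + 1), C (c j i) * X ^ (d i) : ℝ[X])).roots.toFinset.filter
      (fun t => 0 < t)) ⊆ Finset.univ.biUnion (fun j =>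
        ((∑ i ∈ Finset.range (K + 1), C (c j i) * X ^ (d i) : ℝ[X])).roots.toFinset.filter (fun t => 0 < t)) := by
    intro x hx
    rw [mem_filter, Multiset.mem_toFinset, mem_roots hP0, IsRoot.def, eval_prod, Finset.prod_eq_zero_iff] at hx
    obtain ⟨⟨j, _, hj⟩, hx0⟩ := hx
    rw [mem_biUnion]
    refine ⟨j, mem_univ _, ?_⟩
    rw [mem_filter, Multiset.mem_toFinset, mem_roots (hne j), IsRoot.def]
    exact ⟨hj, hx0⟩
  refine (card_le_card hsub).trans (card_biUnion_le.trans ?_)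
  calc ∑ j, ((((∑ i ∈ Finset.range (K + 1), C (c j i) * X ^ (d i) : ℝ[X])).roots.toFinset.filter (fun t => 0 < t))).card
      ≤ ∑ _j : Fin m, K := Finset.sum_le_sum (fun j _ =>
          ((StubVLawTwo.card_filter_pos_le_countP _).trans (roots_countP_pos_le_signVariations _)).trans
            (signVariations_sparse_le K d hd (c j) (hc j)))
    _ = K * m := by simp [mul_comm]

/-- **THE SHARP SECTOR IS LINEAR FOR EVERY NUMBER OF TERMS**: `Z₊(κ X^N + ∏_j f_j) ≤ 2(Km + 1)` for `m` Descartes-sharp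
`(K+1)`-nomials on a common support; every `N`, `κ`, `m`, `K ≥ 1`, every support. [this file's theorem] -/
theorem sharpK_sector_pos_roots {m : ℕ} (K : ℕ) (hK : 1 ≤ K) (d : ℕ → ℕ) (hd : StrictMono d) (c : Fin m → ℕ → ℝ)
    (hc : ∀ j i, i < K + 1 → c j i ≠ 0)
    (hsharp : ∀ j, K ≤ (((∑ i ∈ Finset.range (K + 1), C (c j i) * X ^ (d i) : ℝ[X])).roots.toFinset.filter
      (fun t => 0 < t)).card) (N : ℕ) (κ : ℝ) :
    ((C κ * X ^ N + ∏ j, (∑ i ∈ Finset.range (K + 1), C (c j i) * X ^ (d i) : ℝ[X])).roots.toFinset.filter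
      (fun t => 0 < t)).card ≤ 2 * (K * m + 1) := by
  classical
  set P : ℝ[X] := ∏ j, (∑ i ∈ Finset.range (K + 1), C (c j i) * X ^ (d i) : ℝ[X]) with hPdef
  rcases Nat.eq_zero_or_pos m with hm | hm
  · subst hm
    have hP1 : P = 1 := by rw [hPdef]; exact Fintype.prod_empty _
    rw [hP1]
    have h2 := countP_pos_roots_le_two_of_coeff_nonneg_off (C κ * X ^ N + 1 : ℝ[X]) N (fun i hi => by
      rw [coeff_add, coeff_C_mul_X_pow, if_neg hi, zero_add, coeff_one]
      split_ifs <;> norm_num)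
    exact ((StubVLawTwo.card_filter_pos_le_countP _).trans h2).trans (by omega)
  obtain ⟨hP0, hZcard'⟩ := prod_sparse_pos_roots_le K d hd c hc
  by_cases hκ : κ = 0
  · subst hκ
    rw [map_zero, zero_mul, zero_add]
    exact hZcard'.trans (by omega)
  set S := (C κ * X ^ N + P).roots.toFinset.filter (fun t => 0 < t) with hSdef
  set Zp := P.roots.toFinset.filter (fun t => 0 < t) with hZp
  have hZcard : Zp.card ≤ K * m := hZcard'
  have hSmem : ∀ z ∈ S, 0 < z ∧ eval z (C κ * X ^ N + P) = 0 := by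
    intro z hz
    rw [hSdef, mem_filter, Multiset.mem_toFinset] at hz
    by_cases h0 : C κ * X ^ N + P = 0
    · rw [h0, roots_zero] at hz
      exact absurd hz.1 (Multiset.notMem_zero _)
    · exact ⟨hz.2, (IsRoot.def).mp ((mem_roots h0).mp hz.1)⟩
  have hPne : ∀ z ∈ S, eval z P ≠ 0 := by
    intro z hz hPz
    have h := (hSmem z hz).2
    rw [eval_add, eval_mul, eval_C, eval_pow, eval_X, hPz, add_zero] at h
    rcases mul_eq_zero.mp h with h1 | h1
    · exact hκ h1
    · exact absurd h1 (pow_ne_zero _ (hSmem z hz).1.ne')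
  have hfacne : ∀ z, eval z P ≠ 0 → ∀ j, (∑ i ∈ Finset.range (K + 1), C (c j i) * X ^ (d i) : ℝ[X]).eval z ≠ 0 := by
    intro z hz j hj
    apply hz
    rw [hPdef, eval_prod, Finset.prod_eq_zero_iff]
    exact ⟨j, mem_univ _, hj⟩
  have hfree : ∀ z₁ ∈ S, ∀ z₃ ∈ S, z₁ < z₃ →
      (Zp.filter (fun t => t < z₁)).card = (Zp.filter (fun t => t < z₃)).card →
      ∀ t ∈ Set.Icc z₁ z₃, eval t P ≠ 0 := by
    intro z₁ hz₁ z₃ hz₃ h13 hk13 t ht hPt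
    have ht0 : 0 < t := (hSmem z₁ hz₁).1.trans_le ht.1
    rcases eq_or_lt_of_le ht.2 with h | h
    · exact hPne z₃ hz₃ (h ▸ hPt)
    · have htZ : t ∈ Zp := by
        rw [hZp, mem_filter, Multiset.mem_toFinset, mem_roots hP0]
        exact ⟨hPt, ht0⟩
      have hsub : Zp.filter (fun s => s < z₁) ⊆ Zp.filter (fun s => s < z₃) := by
        intro s hs
        rw [mem_filter] at hs ⊢
        exact ⟨hs.1, hs.2.trans h13⟩
      have hstrict : Zp.filter (fun s => s < z₁) ⊂ Zp.filter (fun s => s < z₃) := by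
        refine Finset.ssubset_iff_subset_ne.mpr ⟨hsub, fun heq => ?_⟩
        have ht1 : t ∈ Zp.filter (fun s => s < z₁) := by
          rw [heq, mem_filter]
          exact ⟨htZ, h⟩
        rw [mem_filter] at ht1
        exact absurd ht1.2 (not_lt.mpr ht.1)
      exact absurd hk13 (Finset.card_lt_card hstrict).ne
  -- at a zero of X h′ − N h off the zeros of P, Φ = N
  have hΦ : ∀ w : ℝ, 0 < w → eval w P ≠ 0 →
      eval w (X * derivative (C κ * X ^ N + P) - C (N : ℝ) * (C κ * X ^ N + P)) = 0 →
      (∑ j, w * (derivative (∑ i ∈ Finset.range (K + 1), C (c j i) * X ^ (d i) : ℝ[X])).eval w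
          / (∑ i ∈ Finset.range (K + 1), C (c j i) * X ^ (d i) : ℝ[X]).eval w) = N := by
    intro w hw hPw hd0
    have hE : X * derivative (C κ * X ^ N + P) - C (N : ℝ) * (C κ * X ^ N + P)
        = X * derivative P - C (N : ℝ) * P := by
      have h := euler_sub_monomial P (-κ) N
      rw [map_neg] at h
      rw [show C κ * X ^ N + P = P - -C κ * X ^ N by ring]
      exact h
    rw [hE, eval_sub, eval_mul, eval_X, eval_mul, eval_C, hPdef,
      eval_euler_prod_general _ (hfacne w hPw), ← eval_prod] at hd0
    rw [hPdef] at hPw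
    have : eval w (∏ j, (∑ i ∈ Finset.range (K + 1), C (c j i) * X ^ (d i) : ℝ[X])) *
        ((∑ j, w * (derivative (∑ i ∈ Finset.range (K + 1), C (c j i) * X ^ (d i) : ℝ[X])).eval w
          / (∑ i ∈ Finset.range (K + 1), C (c j i) * X ^ (d i) : ℝ[X]).eval w) - N) = 0 := by
      rw [mul_sub]; linarith
    rcases mul_eq_zero.mp this with h1 | h1
    · exact absurd h1 hPw
    · linarith
  -- Φ strictly decreasing on zero-free intervals
  have hΦanti : ∀ w₁ w₂ : ℝ, 0 < w₁ → w₁ < w₂ → (∀ t ∈ Set.Icc w₁ w₂, eval t P ≠ 0) →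
      (∑ j, w₂ * (derivative (∑ i ∈ Finset.range (K + 1), C (c j i) * X ^ (d i) : ℝ[X])).eval w₂
          / (∑ i ∈ Finset.range (K + 1), C (c j i) * X ^ (d i) : ℝ[X]).eval w₂)
        < ∑ j, w₁ * (derivative (∑ i ∈ Finset.range (K + 1), C (c j i) * X ^ (d i) : ℝ[X])).eval w₁
          / (∑ i ∈ Finset.range (K + 1), C (c j i) * X ^ (d i) : ℝ[X]).eval w₁ := by
    intro w₁ w₂ hw₁ hw hfr
    have hne : (Finset.univ : Finset (Fin m)).Nonempty := ⟨⟨0, hm⟩, mem_univ _⟩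
    exact Finset.sum_lt_sum_of_nonempty hne (fun j _ =>
      sharp_phi_strictAnti K hK d hd (c j) (hc j) (hsharp j) hw₁ hw (fun t ht => hfacne t (hfr t ht) j))
  have hfiber : ∀ v ∈ S.image (fun z => (Zp.filter (fun t => t < z)).card),
      (S.filter (fun z => (Zp.filter (fun t => t < z)).card = v)).card ≤ 2 := by
    intro v _
    by_contra hcon
    push Not at hcon
    set F := S.filter (fun z => (Zp.filter (fun t => t < z)).card = v) with hF
    have hFS : ∀ z ∈ F, z ∈ S ∧ (Zp.filter (fun t => t < z)).card = v := by
      intro z hz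
      rw [hF, mem_filter] at hz
      exact hz
    have hne : F.Nonempty := Finset.card_pos.mp (by omega)
    have hz₁F : F.min' hne ∈ F := Finset.min'_mem F hne
    have hF₁card : 2 ≤ (F.erase (F.min' hne)).card := by
      rw [Finset.card_erase_of_mem hz₁F]
      omega
    have hne₁ : (F.erase (F.min' hne)).Nonempty := Finset.card_pos.mp (by omega)
    have hz₂F₁ : (F.erase (F.min' hne)).min' hne₁ ∈ F.erase (F.min' hne) := Finset.min'_mem _ hne₁
    have hne₂ : ((F.erase (F.min' hne)).erase ((F.erase (F.min' hne)).min' hne₁)).Nonempty :=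
      Finset.card_pos.mp (by rw [Finset.card_erase_of_mem hz₂F₁]; omega)
    obtain ⟨z₃, hz₃F₂⟩ := hne₂
    set z₁ := F.min' hne with hz₁
    set z₂ := (F.erase z₁).min' hne₁ with hz₂
    have hz₂F : z₂ ∈ F := Finset.mem_of_mem_erase hz₂F₁
    have hz₃F₁ : z₃ ∈ F.erase z₁ := Finset.mem_of_mem_erase hz₃F₂
    have hz₃F : z₃ ∈ F := Finset.mem_of_mem_erase hz₃F₁
    have h12 : z₁ < z₂ :=
      lt_of_le_of_ne (Finset.min'_le F z₂ hz₂F) (Finset.ne_of_mem_erase hz₂F₁).symm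
    have h23 : z₂ < z₃ :=
      lt_of_le_of_ne (Finset.min'_le _ z₃ hz₃F₁) (Finset.ne_of_mem_erase hz₃F₂).symm
    obtain ⟨hz₁S, hk₁⟩ := hFS z₁ hz₁F
    obtain ⟨hz₂S, _⟩ := hFS z₂ hz₂F
    obtain ⟨hz₃S, hk₃⟩ := hFS z₃ hz₃F
    have free13 := hfree z₁ hz₁S z₃ hz₃S (h12.trans h23) (hk₁.trans hk₃.symm)
    have hz₁pos : 0 < z₁ := (hSmem z₁ hz₁S).1
    obtain ⟨w₁, hw₁, hd₁⟩ := exists_root_euler_between (C κ * X ^ N + P) N hz₁pos h12 (hSmem z₁ hz₁S).2 (hSmem z₂ hz₂S).2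
    obtain ⟨w₂, hw₂, hd₂⟩ := exists_root_euler_between (C κ * X ^ N + P) N (hz₁pos.trans h12) h23
      (hSmem z₂ hz₂S).2 (hSmem z₃ hz₃S).2
    have hw₁pos : 0 < w₁ := hz₁pos.trans hw₁.1
    have hw₁₂ : w₁ < w₂ := hw₁.2.trans hw₂.1
    have hIcc : Set.Icc w₁ w₂ ⊆ Set.Icc z₁ z₃ :=
      fun t ht => ⟨hw₁.1.le.trans ht.1, ht.2.trans hw₂.2.le⟩
    have hg₁ := free13 w₁ (hIcc ⟨le_rfl, hw₁₂.le⟩)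
    have hg₂ := free13 w₂ (hIcc ⟨hw₁₂.le, le_rfl⟩)
    have hΦ₁ := hΦ w₁ hw₁pos hg₁ hd₁
    have hΦ₂ := hΦ w₂ (hw₁pos.trans hw₁₂) hg₂ hd₂
    have hlt := hΦanti w₁ w₂ hw₁pos hw₁₂ (fun t ht => free13 t (hIcc ht))
    rw [hΦ₁, hΦ₂] at hlt
    exact lt_irrefl _ hlt
  have himg : S.image (fun z => (Zp.filter (fun t => t < z)).card) ⊆ Finset.range (K * m + 1) := by
    intro v hv
    rw [Finset.mem_image] at hv
    obtain ⟨z, _, rfl⟩ := hv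
    rw [Finset.mem_range]
    exact Nat.lt_succ_of_le ((Finset.card_filter_le _ _).trans hZcard)
  calc S.card = ∑ v ∈ S.image (fun z => (Zp.filter (fun t => t < z)).card),
        (S.filter (fun z => (Zp.filter (fun t => t < z)).card = v)).card :=
        Finset.card_eq_sum_card_image _ S
    _ ≤ ∑ _v ∈ S.image (fun z => (Zp.filter (fun t => t < z)).card), 2 := Finset.sum_le_sum hfiber
    _ = 2 * (S.image (fun z => (Zp.filter (fun t => t < z)).card)).card := by
        rw [Finset.sum_const, smul_eq_mul, mul_comm]
    _ ≤ 2 * (K * m + 1) :=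
        Nat.mul_le_mul_left 2 ((Finset.card_le_card himg).trans (by rw [Finset.card_range]))

/-! ### The line's vocabulary: `d : Fin K → ℕ`, `a : Fin m → Fin K → ℝ` -/

/-- **THE SHARP SECTOR OF THE CLASS, EVERY FORMAT `(m, K)`, EVERY SUPPORT, EVERY COUPLING** (line shape
`C c * X ^ (m * d l₀) + ∏ j, fewnomial d (a j)` unfolded): `K ≥ 2`, `d` strictly increasing, all `a j l ≠ 0`, every factor with
`K − 1` distinct positive zeros ⇒ `Z₊ ≤ 2((K − 1)m + 1)`. [this file's theorem] -/
theorem sharpK_sector_class {m K : ℕ} (hK : 2 ≤ K) (d : Fin K → ℕ) (hd : StrictMono d) (l₀ : Fin K)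
    (a : Fin m → Fin K → ℝ) (ha : ∀ j l, a j l ≠ 0)
    (hsharp : ∀ j, K - 1 ≤ (((∑ l, C (a j l) * X ^ (d l) : ℝ[X])).roots.toFinset.filter (fun t => 0 < t)).card) (c : ℝ) :
    ((C c * X ^ (m * d l₀) + ∏ j, ∑ l, C (a j l) * X ^ (d l) : ℝ[X]).roots.toFinset.filter (fun t => 0 < t)).card
      ≤ 2 * ((K - 1) * m + 1) := by
  classical
  obtain ⟨K', rfl⟩ : ∃ K', K = K' + 1 := ⟨K - 1, by omega⟩
  have hK' : 1 ≤ K' := by omega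
  -- extend the support and the coefficient rows to ℕ
  set dx : ℕ → ℕ := fun i => if h : i < K' + 1 then d ⟨i, h⟩ else d ⟨K', by omega⟩ + (i - K') with hdx
  set cx : Fin m → ℕ → ℝ := fun j i => if h : i < K' + 1 then a j ⟨i, h⟩ else 0 with hcx
  have hdx_in : ∀ i (h : i < K' + 1), dx i = d ⟨i, h⟩ := fun i h => by simp only [hdx]; exact dif_pos h
  have hdmono : StrictMono dx := by
    intro i j hij
    by_cases hj : j < K' + 1
    · have hi : i < K' + 1 := by omega
      rw [hdx_in i hi, hdx_in j hj]
      exact hd (Fin.mk_lt_mk.mpr hij)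
    · have ej : dx j = d ⟨K', by omega⟩ + (j - K') := by simp only [hdx]; exact dif_neg hj
      rw [ej]
      by_cases hi : i < K' + 1
      · rw [hdx_in i hi]
        have : d ⟨i, hi⟩ ≤ d ⟨K', by omega⟩ := hd.monotone (Fin.mk_le_mk.mpr (by omega))
        omega
      · have ei : dx i = d ⟨K', by omega⟩ + (i - K') := by simp only [hdx]; exact dif_neg hi
        rw [ei]
        omega
  have hcx_ne : ∀ j i, i < K' + 1 → cx j i ≠ 0 := by
    intro j i hi
    simp only [hcx, dif_pos hi]
    exact ha j _
  have hfac : ∀ j, (∑ l, C (a j l) * X ^ (d l) : ℝ[X]) = ∑ i ∈ Finset.range (K' + 1), C (cx j i) * X ^ (dx i) := by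
    intro j
    rw [← Fin.sum_univ_eq_sum_range (fun i => C (cx j i) * X ^ (dx i)) (K' + 1)]
    refine Finset.sum_congr rfl (fun l _ => ?_)
    have hl : (l : ℕ) < K' + 1 := l.isLt
    simp only [hcx, hdx, dif_pos hl, Fin.eta]
  have hsharp' : ∀ j, K' ≤ (((∑ i ∈ Finset.range (K' + 1), C (cx j i) * X ^ (dx i) : ℝ[X])).roots.toFinset.filter
      (fun t => 0 < t)).card := by
    intro j
    rw [← hfac j]
    have := hsharp j
    simpa using this
  rw [Finset.prod_congr rfl (fun j _ => hfac j)]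
  have h := sharpK_sector_pos_roots K' hK' dx hdmono cx hcx_ne hsharp' (m * d l₀) c
  have e : (K' + 1 - 1) = K' := by omega
  rw [e]
  exact h

end ProductPlusOne

end Summit.ValiantsHypothesis.ValiantsHypothesis.Theorems.LacunarySymmetroidMatrixDescartes
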